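import Summits.AnomalousDissipation.AnomalousDissipation.Theorems.MarginalStabilityChainChainRealisationStubCompactLimitsOfShiftsA
import HarnessLib

/-!
# Stub `stub_compactLimitsOfShifts` of the line `SketchIdeator2`, part A2: limits of classical
# Navier–Stokes solutions are classical — evaluation-wise convergence of the jets
# (crux stmt-AnomalousDissipation-14249, `MarginalStabilityChain.ChainRealisation`)

Sequel of part A (`…StubCompactLimitsOfShiftsA`): the same limit theorem with the convergence of
the first and second derivatives of the space–time lifts required only after evaluation at fixed
vectors (`clsA_limit_isClassicalNSSolutionOn'`, registered form `clsA_limitClassicalEval`).  This is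
the form produced by locally uniform convergence of `iteratedFDeriv 1` and `iteratedFDeriv 2`
(Mathlib `iteratedFDeriv_one_apply`, `iteratedFDeriv_two_apply`) in the Arzelà–Ascoli extraction of
time-translates.

References: C. Foias, O. Manley, R. Rosa, R. Temam, *Navier–Stokes Equations and Turbulence*,
CUP 2001, Ch. III §2.
-/

set_option linter.dupNamespace false

noncomputable section

open MeasureTheory Set Filter Topology
open scoped InnerProductSpace
open Literature.Analysis.FunctionSpaces Literature.Analysis.FunctionSpaces.Torus

namespace Summit.AnomalousDissipation.AnomalousDissipation.Theorems.ChainRealisation.SeparatrixFluxPinning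

/-! ## §A.5 The same with evaluation-wise convergence of the jets -/

/-- **Limits of classical solutions are classical — evaluation-wise hypotheses.**  As
`clsA_limit_isClassicalNSSolutionOn`, but the convergence of the first and second derivatives of
the lifts is only required after evaluation at (pairs of) fixed vectors (the form delivered by
uniform convergence of `iteratedFDeriv 1`, `iteratedFDeriv 2` through `iteratedFDeriv_one_apply`,
`iteratedFDeriv_two_apply`). -/
theorem clsA_limit_isClassicalNSSolutionOn' {a ν : ℝ} {F : (UnitAddTorus (Fin 3)) → (EuclideanSpace ℝ (Fin 3))}
    {u : ℕ → ℝ → (UnitAddTorus (Fin 3)) → (EuclideanSpace ℝ (Fin 3))} {p : ℕ → ℝ → (UnitAddTorus (Fin 3)) → ℝ}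
    {v : ℝ → (UnitAddTorus (Fin 3)) → (EuclideanSpace ℝ (Fin 3))} {q : ℝ → (UnitAddTorus (Fin 3)) → ℝ}
    (hsol : ∀ n, IsClassicalNSSolutionOn (Ici a) ν (fun _ => F) (u n) (p n))
    (hv : IsSmoothSpaceTimeOn (Ici a) v) (hq : IsSmoothSpaceTimeOn (Ici a) q)
    (h0 : ∀ z ∈ Ici a ×ˢ (univ : Set (EuclideanSpace ℝ (Fin 3))), Tendsto (fun n => stLift (u n) z) atTop (𝓝 (stLift v z)))
    (h1 : ∀ z ∈ Ici a ×ˢ (univ : Set (EuclideanSpace ℝ (Fin 3))), ∀ w : ℝ × EuclideanSpace ℝ (Fin 3),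
      Tendsto (fun n => fderivWithin ℝ (stLift (u n)) (Ici a ×ˢ univ) z w) atTop
        (𝓝 (fderivWithin ℝ (stLift v) (Ici a ×ˢ univ) z w)))
    (h2 : ∀ z ∈ Ici a ×ˢ (univ : Set (EuclideanSpace ℝ (Fin 3))), ∀ w w' : ℝ × EuclideanSpace ℝ (Fin 3),
      Tendsto (fun n => fderivWithin ℝ (fderivWithin ℝ (stLift (u n)) (Ici a ×ˢ univ)) (Ici a ×ˢ univ) z w w')
        atTop (𝓝 (fderivWithin ℝ (fderivWithin ℝ (stLift v) (Ici a ×ˢ univ)) (Ici a ×ˢ univ) z w w')))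
    (hp1 : ∀ z ∈ Ici a ×ˢ (univ : Set (EuclideanSpace ℝ (Fin 3))), ∀ w : ℝ × EuclideanSpace ℝ (Fin 3),
      Tendsto (fun n => fderivWithin ℝ (stLift (p n)) (Ici a ×ˢ univ) z w) atTop
        (𝓝 (fderivWithin ℝ (stLift q) (Ici a ×ˢ univ) z w))) :
    IsClassicalNSSolutionOn (Ici a) ν (fun _ => F) v q := by
  have hS : UniqueDiffOn ℝ (Ici a) := uniqueDiffOn_Ici a
  set D : Set (ℝ × (EuclideanSpace ℝ (Fin 3))) := Ici a ×ˢ univ with hD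
  refine ⟨hv, hq, ?_, ?_⟩
  · -- momentum equation
    intro t ht x
    set y : (EuclideanSpace ℝ (Fin 3)) := repr x with hy
    have hx : proj y = x := proj_repr x
    have hz : (t, y) ∈ D := mk_mem_prod ht (mem_univ _)
    set A : ℕ → (ℝ × (EuclideanSpace ℝ (Fin 3))) →L[ℝ] (EuclideanSpace ℝ (Fin 3)) := fun n => fderivWithin ℝ (stLift (u n)) D (t, y) with hA
    set A₀ : (ℝ × (EuclideanSpace ℝ (Fin 3))) →L[ℝ] (EuclideanSpace ℝ (Fin 3)) := fderivWithin ℝ (stLift v) D (t, y) with hA₀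
    set B : ℕ → (ℝ × (EuclideanSpace ℝ (Fin 3))) →L[ℝ] (ℝ × (EuclideanSpace ℝ (Fin 3))) →L[ℝ] (EuclideanSpace ℝ (Fin 3)) :=
      fun n => fderivWithin ℝ (fderivWithin ℝ (stLift (u n)) D) D (t, y) with hB
    set B₀ : (ℝ × (EuclideanSpace ℝ (Fin 3))) →L[ℝ] (ℝ × (EuclideanSpace ℝ (Fin 3))) →L[ℝ] (EuclideanSpace ℝ (Fin 3)) :=
      fderivWithin ℝ (fderivWithin ℝ (stLift v) D) D (t, y) with hB₀
    set P : ℕ → (ℝ × (EuclideanSpace ℝ (Fin 3))) →L[ℝ] ℝ := fun n => fderivWithin ℝ (stLift (p n)) D (t, y) with hP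
    set P₀ : (ℝ × (EuclideanSpace ℝ (Fin 3))) →L[ℝ] ℝ := fderivWithin ℝ (stLift q) D (t, y) with hP₀
    have hAt : ∀ w, Tendsto (fun n => A n w) atTop (𝓝 (A₀ w)) := h1 _ hz
    have hBt : ∀ w w', Tendsto (fun n => B n w w') atTop (𝓝 (B₀ w w')) := h2 _ hz
    have hPt : ∀ w, Tendsto (fun n => P n w) atTop (𝓝 (P₀ w)) := hp1 _ hz
    have hVt : Tendsto (fun n => stLift (u n) (t, y)) atTop (𝓝 (stLift v (t, y))) := h0 _ hz
    have key : ∀ (w : ℝ → (UnitAddTorus (Fin 3)) → (EuclideanSpace ℝ (Fin 3))) (r : ℝ → (UnitAddTorus (Fin 3)) → ℝ), IsSmoothSpaceTimeOn (Ici a) w →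
        IsSmoothSpaceTimeOn (Ici a) r →
        timeDerivWithin (Ici a) w t x = fderivWithin ℝ (stLift w) D (t, y) (1, 0) ∧
        convect (w t) (w t) x =
          ∑ i, (stLift w (t, y)) i • fderivWithin ℝ (stLift w) D (t, y) (0, EuclideanSpace.single i 1) ∧
        laplacian (w t) x =
          ∑ i, fderivWithin ℝ (fderivWithin ℝ (stLift w) D) D (t, y)
            (0, EuclideanSpace.single i 1) (0, EuclideanSpace.single i 1) ∧
        gradient (r t) x =
          ∑ i, fderivWithin ℝ (stLift r) D (t, y) (0, EuclideanSpace.single i 1) •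
            EuclideanSpace.single i (1 : ℝ) := by
      intro w r hw hr
      have hws : IsSmooth (w t) := hw.isSmooth_slice ht
      have hrs : IsSmooth (r t) := hr.isSmooth_slice ht
      refine ⟨?_, ?_, ?_, ?_⟩
      · rw [← hx]; exact hw.timeDerivWithin_apply_proj hS ht y
      · rw [Torus.convect, fderiv_apply_eq_sum_partialDeriv (hws.isContDiff (by simp))]
        refine Finset.sum_congr rfl fun i _ => ?_
        rw [← hx, clsA_partialDeriv_slice_eq hw ht y i]
        rfl
      · rw [laplacian_eq_sum_partialDeriv_partialDeriv hws]
        refine Finset.sum_congr rfl fun i _ => ?_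
        rw [← hx, clsA_partialDeriv_partialDeriv_slice_eq hw hS ht y i i]
      · rw [gradient_eq_sum_partialDeriv (hrs.isContDiff (by simp))]
        refine Finset.sum_congr rfl fun i _ => ?_
        rw [← hx, clsA_partialDeriv_slice_eq hr ht y i]
    have heqn : ∀ n, A n (1, 0) + ∑ i, (stLift (u n) (t, y)) i • A n (0, EuclideanSpace.single i 1) =
        ν • ∑ i, B n (0, EuclideanSpace.single i 1) (0, EuclideanSpace.single i 1) -
          ∑ i, P n (0, EuclideanSpace.single i 1) • EuclideanSpace.single i (1 : ℝ) + F x := by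
      intro n
      obtain ⟨k1, k2, k3, k4⟩ := key (u n) (p n) (hsol n).smooth_velocity (hsol n).smooth_pressure
      have hm := (hsol n).momentum t ht x
      rw [k1, k2, k3, k4] at hm
      exact hm
    have hL : Tendsto (fun n => A n (1, 0) + ∑ i, (stLift (u n) (t, y)) i • A n (0, EuclideanSpace.single i 1))
        atTop (𝓝 (A₀ (1, 0) + ∑ i, (stLift v (t, y)) i • A₀ (0, EuclideanSpace.single i 1))) := by
      refine (hAt _).add (tendsto_finsetSum _ fun i _ => ?_)
      have hc : Tendsto (fun n => (stLift (u n) (t, y)) i) atTop (𝓝 ((stLift v (t, y)) i)) :=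
        ((EuclideanSpace.proj i).continuous.tendsto _).comp hVt
      exact hc.smul (hAt _)
    have hR : Tendsto (fun n => ν • ∑ i, B n (0, EuclideanSpace.single i 1) (0, EuclideanSpace.single i 1) -
          ∑ i, P n (0, EuclideanSpace.single i 1) • EuclideanSpace.single i (1 : ℝ) + F x)
        atTop (𝓝 (ν • ∑ i, B₀ (0, EuclideanSpace.single i 1) (0, EuclideanSpace.single i 1) -
          ∑ i, P₀ (0, EuclideanSpace.single i 1) • EuclideanSpace.single i (1 : ℝ) + F x)) := by
      refine ((Tendsto.const_smul (tendsto_finsetSum _ fun i _ => ?_) ν).sub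
        (tendsto_finsetSum _ fun i _ => ?_)).add tendsto_const_nhds
      · exact hBt _ _
      · exact (hPt _).smul tendsto_const_nhds
    have hlim := tendsto_nhds_unique hL (hR.congr fun n => (heqn n).symm)
    obtain ⟨k1, k2, k3, k4⟩ := key v q hv hq
    rw [k1, k2, k3, k4]
    exact hlim
  · -- divergence free
    intro t ht x
    set y : (EuclideanSpace ℝ (Fin 3)) := repr x with hy
    have hx : proj y = x := proj_repr x
    have hz : (t, y) ∈ D := mk_mem_prod ht (mem_univ _)
    have hdivn : ∀ n, ∑ i, (fderivWithin ℝ (stLift (u n)) D (t, y) (0, EuclideanSpace.single i 1)) i = 0 := by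
      intro n
      have h := (hsol n).divFree t ht x
      rw [divergence_eq_sum_partialDeriv_apply
        (((hsol n).smooth_velocity.isSmooth_slice ht).isContDiff (by simp))] at h
      calc ∑ i, (fderivWithin ℝ (stLift (u n)) D (t, y) (0, EuclideanSpace.single i 1)) i
          = ∑ i, (partialDeriv i (u n t) x) i := by
            refine Finset.sum_congr rfl fun i _ => ?_
            rw [← hx, clsA_partialDeriv_slice_eq (hsol n).smooth_velocity ht y i]
        _ = 0 := h
    have hlim : Tendsto (fun n => ∑ i, (fderivWithin ℝ (stLift (u n)) D (t, y) (0, EuclideanSpace.single i 1)) i)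
        atTop (𝓝 (∑ i, (fderivWithin ℝ (stLift v) D (t, y) (0, EuclideanSpace.single i 1)) i)) :=
      tendsto_finsetSum _ fun i _ =>
        ((EuclideanSpace.proj i).continuous.tendsto _).comp (h1 _ hz _)
    have h0' : ∑ i, (fderivWithin ℝ (stLift v) D (t, y) (0, EuclideanSpace.single i 1)) i = 0 :=
      tendsto_nhds_unique hlim (by simp only [hdivn]; exact tendsto_const_nhds)
    rw [divergence_eq_sum_partialDeriv_apply ((hv.isSmooth_slice ht).isContDiff (by simp))]
    rw [← h0']
    refine Finset.sum_congr rfl fun i _ => ?_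
    rw [← hx, clsA_partialDeriv_slice_eq hv ht y i]

/-- Registered form (explicit binders) of `clsA_limit_isClassicalNSSolutionOn'`: limits of classical
Navier–Stokes solutions on `T³` whose space–time 2-jets converge pointwise, evaluation-wise, are
classical solutions. -/
theorem clsA_limitClassicalEval :
    ∀ (a ν : ℝ) (F : UnitAddTorus (Fin 3) → EuclideanSpace ℝ (Fin 3))
      (u : ℕ → ℝ → UnitAddTorus (Fin 3) → EuclideanSpace ℝ (Fin 3)) (p : ℕ → ℝ → UnitAddTorus (Fin 3) → ℝ)
      (v : ℝ → UnitAddTorus (Fin 3) → EuclideanSpace ℝ (Fin 3)) (q : ℝ → UnitAddTorus (Fin 3) → ℝ),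
      (∀ n, IsClassicalNSSolutionOn (Set.Ici a) ν (fun _ => F) (u n) (p n)) →
      IsSmoothSpaceTimeOn (Set.Ici a) v → IsSmoothSpaceTimeOn (Set.Ici a) q →
      (∀ z ∈ Set.Ici a ×ˢ (Set.univ : Set (EuclideanSpace ℝ (Fin 3))),
        Tendsto (fun n => stLift (u n) z) atTop (𝓝 (stLift v z))) →
      (∀ z ∈ Set.Ici a ×ˢ (Set.univ : Set (EuclideanSpace ℝ (Fin 3))), ∀ w : ℝ × EuclideanSpace ℝ (Fin 3),
        Tendsto (fun n => fderivWithin ℝ (stLift (u n)) (Set.Ici a ×ˢ Set.univ) z w) atTop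
          (𝓝 (fderivWithin ℝ (stLift v) (Set.Ici a ×ˢ Set.univ) z w))) →
      (∀ z ∈ Set.Ici a ×ˢ (Set.univ : Set (EuclideanSpace ℝ (Fin 3))), ∀ w w' : ℝ × EuclideanSpace ℝ (Fin 3),
        Tendsto (fun n => fderivWithin ℝ (fderivWithin ℝ (stLift (u n)) (Set.Ici a ×ˢ Set.univ))
          (Set.Ici a ×ˢ Set.univ) z w w') atTop
          (𝓝 (fderivWithin ℝ (fderivWithin ℝ (stLift v) (Set.Ici a ×ˢ Set.univ)) (Set.Ici a ×ˢ Set.univ) z w w'))) →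
      (∀ z ∈ Set.Ici a ×ˢ (Set.univ : Set (EuclideanSpace ℝ (Fin 3))), ∀ w : ℝ × EuclideanSpace ℝ (Fin 3),
        Tendsto (fun n => fderivWithin ℝ (stLift (p n)) (Set.Ici a ×ˢ Set.univ) z w) atTop
          (𝓝 (fderivWithin ℝ (stLift q) (Set.Ici a ×ˢ Set.univ) z w))) →
      IsClassicalNSSolutionOn (Set.Ici a) ν (fun _ => F) v q :=
  fun _ _ _ _ _ _ _ hsol hv hq h0 h1 h2 hp1 => clsA_limit_isClassicalNSSolutionOn' hsol hv hq h0 h1 h2 hp1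

end Summit.AnomalousDissipation.AnomalousDissipation.Theorems.ChainRealisation.SeparatrixFluxPinning

end
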